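import Mathlib
import HarnessLib
import Summits.NavierStokesRegularity.NavierStokesRegularity.Theorems.TypeILiouvilleStrainLedgerOsgoodTypeIStrain

/-!
# TypeILiouvilleStrainLedgerOsgoodMean — crux (L) stmt-NavierStokesRegularity-10661 `TypeIliouvilleL`,
# residual L_Q / door stmt-4050: THE LOG-TIME MEAN OF THE STRETCHING NUMBER DECIDES, NOT ITS SUPREMUM

Helper for stmt-NavierStokesRegularity-10661 (`--supports`); theorems only, no definitions, no named-fact hypotheses;
closes no item; Navier–Stokes regularity is NOT proved here (leafhand seat of the EulerZoomLiouville route).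
Sequel of the Osgood files (`…OsgoodFloor`, `…OsgoodAligned`, `…OsgoodTypeIStrain`): the divergent-deficit criterion
read as a statement about the MEAN stretching number in logarithmic time `θ = log(−τ)`
(`∫_s^T a(τ) dτ/(−τ) = ∫ a dθ`): a mean `≤ 1 − ε` on long windows already forces triviality, however large the
stretching number is pointwise or on sub-windows.

* §1 `tendsto_deficit_of_logMean_le` — real-variable core: `∫_s^T a/(−τ) ≤ (1−ε)·log((−s)/(−T))` for all `s` near `−∞`
  (`ε > 0`) ⟹ the deficit integral `∫_s^T (1−a)/(−τ) → +∞`.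
* §2 `const_of_typeIVorticity_of_logMean_stretching_le` / `…_alignedStretching_le` — class P, vorticity at the Type-I
  rate `M/(−τ)`, (aligned) stretching `≤ a(τ)/(−τ)` with eventual LOG-TIME MEAN `≤ 1 − ε` ⟹ one constant vector.
* §3 `typeI_eq_zero_of_logMean_strain_le` / `typeI_eq_zero_of_logMean_alignedStretching_le` (+ `knssGauge_…` by the
  stub's verbatim binders) — the same on the Type-I ancient mild class, no vorticity hypothesis.
* §4 `typeI_frequently_logMean_gt_of_ne_zero` — **STRUCTURE LAW OF THE RESIDUAL OF DOOR 4050**: for a NON-ZERO Type-I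
  ancient mild field and ANY continuous majorant `a` of its aligned stretching number on a far past `τ < T`, for every
  `ε > 0`, FREQUENTLY as `s → −∞`: `∫_s^T a(τ) dτ/(−τ) > (1 − ε)·log((−s)/(−T))` — the log-time mean of every aligned
  stretching majorant returns above `1 − ε` on arbitrarily long windows (`limsup` of the window means `≥ 1`).

HONEST LABEL: Grönwall bookkeeping; the scale-invariant corner (mean aligned stretching number `→ 1`) = door 4050 stays
open; nothing here proves a registered stub, (L), or NS regularity; rung 0.
[cite: KochNadirashviliSereginSverak2009, §4 Prop. 4.1, Remark 6.1 (arXiv:0709.3599)] [cite: MajdaBertozziCUP2002, eq. (3.80)] [cite: Constantin1994, §2]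
-/

noncomputable section
open MeasureTheory Filter Set Function Metric
open scoped Topology RealInnerProductSpace ENNReal NNReal
open Literature.Analysis Literature.Analysis.FluidPDE Literature.Analysis.UnboundedOperators
set_option linter.dupNamespace false
namespace Summit.NavierStokesRegularity.NavierStokesRegularity.Theorems.TypeILiouvilleStrainLedger

/-! ## §1 Real-variable core: a log-time mean below one makes the deficit integral diverge -/

/-- If `a` is continuous and, for all `s` near `−∞`, `∫_s^T a(τ) dτ/(−τ) ≤ (1 − ε)(log(−s) − log(−T))` with `ε > 0`,
`T < 0`, then `∫_s^T (1 − a(τ)) dτ/(−τ) → +∞` as `s → −∞` (it is `≥ ε (log(−s) − log(−T))` for `s < T`). [folklore] -/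
theorem tendsto_deficit_of_logMean_le {T ε : ℝ} (hT : T < 0) (hε : 0 < ε) {a : ℝ → ℝ} (hac : Continuous a)
    (hmean : ∀ᶠ s in atBot, ∫ τ in s..T, a τ / (-τ) ≤ (1 - ε) * (Real.log (-s) - Real.log (-T))) :
    Tendsto (fun s : ℝ => ∫ τ in s..T, (1 - a τ) / (-τ)) atBot atTop := by
  have hlow : Tendsto (fun s : ℝ => ε * (Real.log (-s) - Real.log (-T))) atBot atTop := by
    refine Tendsto.const_mul_atTop hε (tendsto_atTop_add_const_right _ _ ?_)
    exact Real.tendsto_log_atTop.comp tendsto_neg_atBot_atTop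
  refine tendsto_atTop_mono' atBot ?_ hlow
  filter_upwards [hmean, eventually_lt_atBot T] with s hs hsT
  have hcont1 : ContinuousOn (fun τ : ℝ => 1 / (-τ)) (uIcc s T) := by
    refine continuousOn_const.div continuousOn_id.neg fun τ hτ => ?_
    rw [uIcc_of_le hsT.le] at hτ
    exact (neg_pos.2 (lt_of_le_of_lt hτ.2 hT)).ne'
  have hcont2 : ContinuousOn (fun τ : ℝ => a τ / (-τ)) (uIcc s T) := by
    refine hac.continuousOn.div continuousOn_id.neg fun τ hτ => ?_
    rw [uIcc_of_le hsT.le] at hτ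
    exact (neg_pos.2 (lt_of_le_of_lt hτ.2 hT)).ne'
  have hsplit : ∫ τ in s..T, (1 - a τ) / (-τ) = (∫ τ in s..T, 1 / (-τ)) - ∫ τ in s..T, a τ / (-τ) := by
    rw [← intervalIntegral.integral_sub hcont1.intervalIntegrable hcont2.intervalIntegrable]
    refine intervalIntegral.integral_congr fun τ _ => ?_
    rw [div_sub_div_same]
  rw [hsplit, integral_one_div_neg_eq_log hsT hT]
  linarith

/-! ## §2 Print's class P: Type-I-rate vorticity and a subunit log-time mean of the stretching number -/

/-- **LOG-TIME MEAN STRETCHING FLOOR (class P, strain form).**  A class-P flow with, for `τ < T < 0`, vorticity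
`‖ω(τ,x)‖ ≤ M/(−τ)` and stretching form `⟪∇v(τ,x)ξ,ξ⟫ ≤ (a(τ)/(−τ))‖ξ‖²` (`a` continuous), whose log-time mean
stretching majorant is eventually subunit — `∫_s^T a/(−τ) ≤ (1−ε) log((−s)/(−T))` for all `s` near `−∞`, some `ε > 0` —
is one constant vector.  The pointwise stretching number may be arbitrarily large on sub-windows.
[cite: MajdaBertozziCUP2002, eq. (3.80)] -/
theorem const_of_typeIVorticity_of_logMean_stretching_le
    {v : ℝ → EuclideanSpace ℝ (Fin 3) → EuclideanSpace ℝ (Fin 3)}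
    (hc : ContinuousOn (uncurry v) (Iio 0 ×ˢ univ))
    (hK : ∃ K : ℝ, ∀ t < 0, ∀ x, ‖v t x‖ ≤ K)
    (hd : ∀ t < 0, IsWeaklyDivFree (v t))
    (hm : ∀ s t : ℝ, s < t → t < 0 → ∀ x,
      v t x = heatExtension (v s) (t - s) x - oseenDuhamel 1 s v v t x)
    {T ε M : ℝ} (hT : T < 0) (hε : 0 < ε) {a : ℝ → ℝ} (hac : Continuous a)
    (hstr : ∀ τ < T, ∀ x ξ : EuclideanSpace ℝ (Fin 3), ⟪fderiv ℝ (v τ) x ξ, ξ⟫ ≤ a τ / (-τ) * ‖ξ‖ ^ 2)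
    (hω : ∀ τ < T, ∀ x : EuclideanSpace ℝ (Fin 3), ‖curl (v τ) x‖ ≤ M / (-τ))
    (hmean : ∀ᶠ s in atBot, ∫ τ in s..T, a τ / (-τ) ≤ (1 - ε) * (Real.log (-s) - Real.log (-T))) :
    ∃ b : EuclideanSpace ℝ (Fin 3), ∀ t < 0, ∀ x, v t x = b :=
  const_of_typeIVorticity_of_divergent_deficit hc hK hd hm hT hac hstr hω
    (tendsto_deficit_of_logMean_le hT hε hac hmean)

/-- **LOG-TIME MEAN STRETCHING FLOOR (class P, aligned).**  The same with the stretching read only along the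
vorticity: `⟪∇v(τ,x) ω, ω⟫ ≤ (a(τ)/(−τ))‖ω‖²`. [cite: MajdaBertozziCUP2002, eq. (3.80)] [cite: Constantin1994, §2] -/
theorem const_of_typeIVorticity_of_logMean_alignedStretching_le
    {v : ℝ → EuclideanSpace ℝ (Fin 3) → EuclideanSpace ℝ (Fin 3)}
    (hc : ContinuousOn (uncurry v) (Iio 0 ×ˢ univ))
    (hK : ∃ K : ℝ, ∀ t < 0, ∀ x, ‖v t x‖ ≤ K)
    (hd : ∀ t < 0, IsWeaklyDivFree (v t))
    (hm : ∀ s t : ℝ, s < t → t < 0 → ∀ x,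
      v t x = heatExtension (v s) (t - s) x - oseenDuhamel 1 s v v t x)
    {T ε M : ℝ} (hT : T < 0) (hε : 0 < ε) {a : ℝ → ℝ} (hac : Continuous a)
    (hstr : ∀ τ < T, ∀ x : EuclideanSpace ℝ (Fin 3),
      ⟪fderiv ℝ (v τ) x (curl (v τ) x), curl (v τ) x⟫ ≤ a τ / (-τ) * ‖curl (v τ) x‖ ^ 2)
    (hω : ∀ τ < T, ∀ x : EuclideanSpace ℝ (Fin 3), ‖curl (v τ) x‖ ≤ M / (-τ))
    (hmean : ∀ᶠ s in atBot, ∫ τ in s..T, a τ / (-τ) ≤ (1 - ε) * (Real.log (-s) - Real.log (-T))) :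
    ∃ b : EuclideanSpace ℝ (Fin 3), ∀ t < 0, ∀ x, v t x = b :=
  const_of_typeIVorticity_of_divergent_alignedDeficit hc hK hd hm hT hac hstr hω
    (tendsto_deficit_of_logMean_le hT hε hac hmean)

/-! ## §3 The Type-I ancient mild class (the registered stub's class): no vorticity hypothesis -/

/-- **LOG-TIME MEAN STRAIN FLOOR ON THE TYPE-I CLASS.**  `IsTypeIAncientMild C u`, `⟪∇u(τ,x)ξ,ξ⟫ ≤ (a(τ)/(−τ))‖ξ‖²`
for `τ < T < 0` (`a` continuous) and an eventually subunit log-time mean `∫_s^T a/(−τ) ≤ (1−ε) log((−s)/(−T))` ⟹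
`u ≡ 0`. [cite: KochNadirashviliSereginSverak2009, §4 Prop. 4.1, Remark 6.1 (arXiv:0709.3599)] -/
theorem typeI_eq_zero_of_logMean_strain_le {C : ℝ}
    {u : ℝ → EuclideanSpace ℝ (Fin 3) → EuclideanSpace ℝ (Fin 3)} (hu : IsTypeIAncientMild C u)
    {T ε : ℝ} (hT : T < 0) (hε : 0 < ε) {a : ℝ → ℝ} (hac : Continuous a)
    (hstr : ∀ τ < T, ∀ x ξ : EuclideanSpace ℝ (Fin 3), ⟪fderiv ℝ (u τ) x ξ, ξ⟫ ≤ a τ / (-τ) * ‖ξ‖ ^ 2)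
    (hmean : ∀ᶠ s in atBot, ∫ τ in s..T, a τ / (-τ) ≤ (1 - ε) * (Real.log (-s) - Real.log (-T))) :
    ∀ t < 0, ∀ x, u t x = 0 :=
  typeI_eq_zero_of_strainDeficit_divergent hu hT hac hstr (tendsto_deficit_of_logMean_le hT hε hac hmean)

/-- **LOG-TIME MEAN ALIGNED-STRETCHING FLOOR ON THE TYPE-I CLASS.**  `IsTypeIAncientMild C u`,
`⟪∇u(τ,x) ω, ω⟫ ≤ (a(τ)/(−τ))‖ω‖²` for `τ < T < 0` and an eventually subunit log-time mean ⟹ `u ≡ 0`.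
[cite: Constantin1994, §2] [cite: KochNadirashviliSereginSverak2009, §4 Prop. 4.1, Remark 6.1 (arXiv:0709.3599)] -/
theorem typeI_eq_zero_of_logMean_alignedStretching_le {C : ℝ}
    {u : ℝ → EuclideanSpace ℝ (Fin 3) → EuclideanSpace ℝ (Fin 3)} (hu : IsTypeIAncientMild C u)
    {T ε : ℝ} (hT : T < 0) (hε : 0 < ε) {a : ℝ → ℝ} (hac : Continuous a)
    (hstr : ∀ τ < T, ∀ x : EuclideanSpace ℝ (Fin 3),
      ⟪fderiv ℝ (u τ) x (curl (u τ) x), curl (u τ) x⟫ ≤ a τ / (-τ) * ‖curl (u τ) x‖ ^ 2)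
    (hmean : ∀ᶠ s in atBot, ∫ τ in s..T, a τ / (-τ) ≤ (1 - ε) * (Real.log (-s) - Real.log (-T))) :
    ∀ t < 0, ∀ x, u t x = 0 :=
  typeI_eq_zero_of_alignedDeficit_divergent hu hT hac hstr (tendsto_deficit_of_logMean_le hT hε hac hmean)

/-- The registered stub `stub_typeIAncientLiouville_knssGauge` HOLDS on the subunit-log-mean stratum (aligned form):
its literal hypotheses plus a continuous aligned-stretching majorant with eventually subunit log-time mean give `u ≡ 0`.
[cite: KochNadirashviliSereginSverak2009, §4 p. 8 (arXiv:0709.3599)] -/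
theorem knssGauge_eq_zero_of_logMean_alignedStretching_le (C : ℝ)
    (u : ℝ → EuclideanSpace ℝ (Fin 3) → EuclideanSpace ℝ (Fin 3))
    (hu : ContDiffOn ℝ (⊤ : ℕ∞) (Function.uncurry u) (Set.Iio 0 ×ˢ Set.univ) ∧
      (∀ t < 0, Literature.Analysis.FluidPDE.VectorCalculus.IsDivFree (u t)) ∧
      (∀ s t : ℝ, s < t → t < 0 → ∀ x, u t x = Literature.Analysis.FluidPDE.heatFlow (u s) (t - s) x -
        ∫ τ in Set.Ioo s t, ∫ y, Literature.Analysis.FluidPDE.oseenKernel (t - τ) (x - y) (u τ y) (u τ y)) ∧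
      Literature.Analysis.FluidPDE.HasTypeITimeDecay C u)
    {T ε : ℝ} (hT : T < 0) (hε : 0 < ε) {a : ℝ → ℝ} (hac : Continuous a)
    (hstr : ∀ τ < T, ∀ x : EuclideanSpace ℝ (Fin 3),
      ⟪fderiv ℝ (u τ) x (curl (u τ) x), curl (u τ) x⟫ ≤ a τ / (-τ) * ‖curl (u τ) x‖ ^ 2)
    (hmean : ∀ᶠ s in atBot, ∫ τ in s..T, a τ / (-τ) ≤ (1 - ε) * (Real.log (-s) - Real.log (-T))) :
    ∀ t < 0, ∀ x, u t x = 0 :=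
  typeI_eq_zero_of_logMean_alignedStretching_le (isTypeIAncientMild_iff.2 hu) hT hε hac hstr hmean

/-! ## §4 Structure law of the residual of door 4050 on the strain axis -/

/-- **STRUCTURE LAW: A NON-ZERO TYPE-I ANCIENT MILD FIELD HAS LOG-TIME MEAN ALIGNED STRETCHING RETURNING TO 1.**  Let
`u` be a Type-I ancient mild field which does not vanish identically, `T < 0`, and `a` ANY continuous majorant of its
aligned stretching number on `τ < T` (`⟪∇u(τ,x) ω, ω⟫ ≤ (a(τ)/(−τ))‖ω‖²`).  Then for every `ε > 0`, frequently as
`s → −∞`: `∫_s^T a(τ) dτ/(−τ) > (1 − ε)(log(−s) − log(−T))` — the window means of `a` in log-time have `limsup ≥ 1`.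
[cite: Constantin1994, §2] [cite: KochNadirashviliSereginSverak2009, §4 Prop. 4.1, Remark 6.1 (arXiv:0709.3599)] -/
theorem typeI_frequently_logMean_gt_of_ne_zero {C : ℝ}
    {u : ℝ → EuclideanSpace ℝ (Fin 3) → EuclideanSpace ℝ (Fin 3)} (hu : IsTypeIAncientMild C u)
    (hne : ∃ t < 0, ∃ x, u t x ≠ 0)
    {T : ℝ} (hT : T < 0) {a : ℝ → ℝ} (hac : Continuous a)
    (hstr : ∀ τ < T, ∀ x : EuclideanSpace ℝ (Fin 3),
      ⟪fderiv ℝ (u τ) x (curl (u τ) x), curl (u τ) x⟫ ≤ a τ / (-τ) * ‖curl (u τ) x‖ ^ 2)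
    {ε : ℝ} (hε : 0 < ε) :
    ∃ᶠ s in atBot, (1 - ε) * (Real.log (-s) - Real.log (-T)) < ∫ τ in s..T, a τ / (-τ) := by
  by_contra hcon
  rw [Filter.not_frequently] at hcon
  have hmean : ∀ᶠ s in atBot, ∫ τ in s..T, a τ / (-τ) ≤ (1 - ε) * (Real.log (-s) - Real.log (-T)) :=
    hcon.mono fun s hs => not_lt.1 hs
  obtain ⟨t, ht, x, hx⟩ := hne
  exact hx (typeI_eq_zero_of_logMean_alignedStretching_le hu hT hε hac hstr hmean t ht x)

/-- The same structure law by a DIVERGENT-DEFICIT NEGATION: for a non-zero Type-I ancient mild field and any continuous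
aligned-stretching majorant `a` on `τ < T < 0`, the deficit integral `∫_s^T (1 − a)/(−τ)` does NOT tend to `+∞` as
`s → −∞`. [cite: Constantin1994, §2] [cite: KochNadirashviliSereginSverak2009, §4 (arXiv:0709.3599)] -/
theorem typeI_not_tendsto_alignedDeficit_of_ne_zero {C : ℝ}
    {u : ℝ → EuclideanSpace ℝ (Fin 3) → EuclideanSpace ℝ (Fin 3)} (hu : IsTypeIAncientMild C u)
    (hne : ∃ t < 0, ∃ x, u t x ≠ 0)
    {T : ℝ} (hT : T < 0) {a : ℝ → ℝ} (hac : Continuous a)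
    (hstr : ∀ τ < T, ∀ x : EuclideanSpace ℝ (Fin 3),
      ⟪fderiv ℝ (u τ) x (curl (u τ) x), curl (u τ) x⟫ ≤ a τ / (-τ) * ‖curl (u τ) x‖ ^ 2) :
    ¬ Tendsto (fun s : ℝ => ∫ τ in s..T, (1 - a τ) / (-τ)) atBot atTop := by
  intro hdiv
  obtain ⟨t, ht, x, hx⟩ := hne
  exact hx (typeI_eq_zero_of_alignedDeficit_divergent hu hT hac hstr hdiv t ht x)

end Summit.NavierStokesRegularity.NavierStokesRegularity.Theorems.TypeILiouvilleStrainLedger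

end
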